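import Summits.NavierStokesRegularity.NavierStokesRegularity.Theses.RellichScar
import Summits.NavierStokesRegularity.NavierStokesRegularity.Theorems.SymmetricScarExists.Negative.SpiralWorld

/-!
# Crux `SymmetricScarExists` (stmt-NavierStokesRegularity-11718), line `rdss-screw-split`: the RDSS world witnesses child A

Helper file of the line lead (c3; `--supports stmt-NavierStokesRegularity-11718`; theorems only).  Child A of the
screw split (`RdssScarSelection`: "if a singular apex profile exists, one exists whose scar is fixed by ONE
screw-dilation `(c, θ)`, `c > 1`, or is axisymmetric") is TRUE in every world containing a singular apex profile
that is a.e. rotated-discretely-self-similar: such a profile is its own witness, since a.e. equality of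
`R_θ D_c u` and `u` on the slab makes every scar functional vanish identically.  This is the calibration
"A holds in the periodic / spiral worlds" of the line card (where the crux's failure is localised in child C,
the Type-I RDSS Liouville wall), recorded as a theorem: `rdssScarSelection_witness_of_aeScrewInvariant`.

References: Z. Bradshaw, T.-P. Tsai, Comm. PDE 42 (2017), §1 (RDSS fields) [BradshawTsai2017CPDE];
B. Pineau, V. Vicol, arXiv:2607.09619, Remark 1.5 [PineauVicol2026].
-/

noncomputable section

open MeasureTheory Set Function Filter Topology TopologicalSpace Metric
open scoped NNReal ENNReal

namespace Summit.NavierStokesRegularity.NavierStokesRegularity.Theorems.SymmetricScarExists.RdssSplit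

open Literature.Analysis.FluidPDE
open Summit.NavierStokesRegularity.NavierStokesRegularity.Theses.RellichScar
open Summit.NavierStokesRegularity.NavierStokesRegularity.Theorems.SymmetricScarExists.Negative

set_option linter.dupNamespace false

/-- A.e. equality on the slab kills the scar functional: if `f = g` a.e. on `(−∞,0) × ℝ³` then
`ess sup_{(−δ,0)×K} ‖f − g‖ = 0` for every `δ` and `K`, hence it tends to `0`. [folklore] -/
theorem tendsto_scar_of_ae_eq_slab {f g : ℝ → EuclideanSpace ℝ (Fin 3) → EuclideanSpace ℝ (Fin 3)}
    (h : uncurry f =ᵐ[volume.restrict (Iio (0 : ℝ) ×ˢ (univ : Set (EuclideanSpace ℝ (Fin 3))))] uncurry g)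
    (K : Set (EuclideanSpace ℝ (Fin 3))) :
    Tendsto (fun δ : ℝ => eLpNorm (uncurry f - uncurry g) ⊤ (volume.restrict (Ioo (-δ) 0 ×ˢ K)))
      (𝓝[>] 0) (𝓝 0) := by
  have hzero : ∀ δ : ℝ, eLpNorm (uncurry f - uncurry g) ⊤ (volume.restrict (Ioo (-δ) 0 ×ˢ K)) = 0 := by
    intro δ
    have hsub : Ioo (-δ) 0 ×ˢ K ⊆ Iio (0 : ℝ) ×ˢ (univ : Set (EuclideanSpace ℝ (Fin 3))) :=
      prod_mono (fun t ht => ht.2) (subset_univ K)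
    have h' : uncurry f =ᵐ[volume.restrict (Ioo (-δ) 0 ×ˢ K)] uncurry g :=
      ae_restrict_of_ae_restrict_of_subset hsub h
    have h0 : uncurry f - uncurry g =ᵐ[volume.restrict (Ioo (-δ) 0 ×ˢ K)] 0 := by
      filter_upwards [h'] with z hz
      simp only [Pi.sub_apply, hz, sub_self, Pi.zero_apply]
    rw [eLpNorm_congr_ae h0, eLpNorm_zero]
  simp only [hzero]
  exact tendsto_const_nhds

/-- **An a.e. screw-invariant singular apex profile witnesses child A** (`RdssScarSelection`) of the screw
split: if a suitable weak solution on the slab with a weak gradient, `𝐈 < ∞` and the apex bound of constant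
`C`, singular at the origin, satisfies `R_θ D_c u = u` a.e. on the slab for some `c > 1`, then A's conclusion
holds for this `C` with witness `u` itself (constant `C' = C`, screw `(c, θ)`): a.e. equality makes the scar
of `R_θ D_c u` equal to the scar of `u`.  So A is true in every world with an RDSS (in particular λ-DSS or
α-RSS) singular apex profile — the worlds in which the crux's failure sits in child C. [cite: BradshawTsai2017CPDE, §1; PineauVicol2026, Remark 1.5] -/
theorem rdssScarSelection_witness_of_aeScrewInvariant :
    ∀ (u : ℝ → EuclideanSpace ℝ (Fin 3) → EuclideanSpace ℝ (Fin 3)) (p : ℝ → EuclideanSpace ℝ (Fin 3) → ℝ) (G : ℝ → EuclideanSpace ℝ (Fin 3) → EuclideanSpace ℝ (Fin 3) →L[ℝ] EuclideanSpace ℝ (Fin 3)) (C c θ : ℝ), IsSuitableWeakSolutionOn (slab (EuclideanSpace ℝ (Fin 3)) (Iio 0) isOpen_Iio) 1 0 u p → HasWeakSpatialGradientOn (slab (EuclideanSpace ℝ (Fin 3)) (Iio 0) isOpen_Iio) u G → typeIBound (Iio (0 : ℝ) ×ˢ univ) u p G < ⊤ → HasTypeIDecay C u → IsBackwardSingularPoint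 u 0 → 1 < c → uncurry (fun t x => rotZ θ (nsRescale c u t (rotZ (-θ) x))) =ᵐ[volume.restrict (Iio (0 : ℝ) ×ˢ univ)] uncurry u → ∃ (C' : ℝ) (u : ℝ → EuclideanSpace ℝ (Fin 3) → EuclideanSpace ℝ (Fin 3)) (p : ℝ → EuclideanSpace ℝ (Fin 3) → ℝ) (G : ℝ → EuclideanSpace ℝ (Fin 3) → EuclideanSpace ℝ (Fin 3) →L[ℝ] EuclideanSpace ℝ (Fin 3)), IsSuitableWeakSolutionOn (slab (EuclideanSpace ℝ (Fin 3)) (Iio 0) isOpen_Iio) 1 0 u p ∧ HasWeakSpatialGradientOn (slab (EuclideanSpace ℝ (Fin 3)) (Iio 0) isOpen_Iio) u G ∧ typeIBound (Iio (0 : ℝ) ×ˢ univ) u p G < ⊤ ∧ HasTypeIDecay C' u ∧ IsBackwardSingularPoint u 0 ∧ ((∃ c θ : ℝ, 1 < c ∧ ∀ K : Set (EuclideanSpace ℝ (Fin 3)), IsCompact K → (0 : EuclideanSpace ℝ (Fin 3)) ∉ K → Tendsto (fun δ : ℝ => eLpNorm (uncurry (fun t x => rotZ θ (nsRescale c u t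 (rotZ (-θ) x))) - uncurry u) ⊤ (volume.restrict (Ioo (-δ) 0 ×ˢ K))) (nhdsWithin 0 (Ioi 0)) (nhds 0)) ∨ (∀ θ : ℝ, ∀ K : Set (EuclideanSpace ℝ (Fin 3)), IsCompact K → (0 : EuclideanSpace ℝ (Fin 3)) ∉ K → Tendsto (fun δ : ℝ => eLpNorm (uncurry (fun t x => rotZ θ (u t (rotZ (-θ) x))) - uncurry u) ⊤ (volume.restrict (Ioo (-δ) 0 ×ˢ K))) (nhdsWithin 0 (Ioi 0)) (nhds 0))) := by
  intro u p G C c θ hsw hwg hI hdec hsing hc hrdss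
  exact ⟨C, u, p, G, hsw, hwg, hI, hdec, hsing,
    Or.inl ⟨c, θ, hc, fun K _ _ => tendsto_scar_of_ae_eq_slab hrdss K⟩⟩

end Summit.NavierStokesRegularity.NavierStokesRegularity.Theorems.SymmetricScarExists.RdssSplit

end
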